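import Summits.Parity.GeneralizedHardyLittlewood.Theorems.LiouvilleMADEngineToGHLTupleLadder
import Summits.Parity.GeneralizedHardyLittlewood.Theorems.LiouvilleMADEngineToGHLPairsReach
import Summits.Parity.GeneralizedHardyLittlewood.Theorems.LiouvilleMADEngineToGHLStubReachDictionary
import Summits.Parity.GeneralizedHardyLittlewood.Theorems.LiouvilleMADEngineToGHLStubReachSingular
import Summits.Parity.GeneralizedHardyLittlewood.Theorems.LiouvilleMADEngineToGHLStubHlTuplesUniform
import Summits.Parity.GeneralizedHardyLittlewood.Theorems.LiouvilleMADEngineToGHLStubTuplesReach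

/-!
# The tuple ladder for the crux `EngineToGHL` (stmt-Parity-14995, route LiouvilleMAD): the REACH of the tuples conjecture

Line `tuple_ladder`, cycle 2 (lead c5).  After the rung (`TupleLadder.tupleLadder_rung`, file
`LiouvilleMADEngineToGHLTupleLadder.lean`) the crux `EngineToGHL ↔ (PairsHL → DicksonFibration.DimOne)` is reduced to
the three inputs `TupleLevel`, `TupleAtoms` (conjecture-grade, Siegel-inert) and the residual `Tuples → DimOne`.  This
file proves the PROVABLE part of that residual — the exact image of the prime `k`-tuples conjecture (Hardy–Littlewood
in `Λ`-form on `[1,N]` for every finite unit-slope tuple `H ∋ 0`) inside Green–Tao's `DimOne`: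

* `TupleLadder.tuplesReach_of_hlTuples` — **Tuples ⇒ Reach**: for every `t ≥ 2`, `Hb`, `L`, `ε`, eventually in `N`,
  the Green–Tao asymptotic `|∑_{n ∈ K ∩ ℤ} ∏ᵢ Λ(ψᵢ(n)) - β_∞ ∏_p β_p| ≤ ε N` holds for EVERY non-degenerate UNIT-SLOPE
  system `ψᵢ(n) = n + bᵢ` (`i < t`) of size `‖Ψ‖_N ≤ L` with BOUNDED shift differences `|bᵢ - bⱼ| ≤ Hb` — uniformly
  in the shifts `|bᵢ| ≤ L N` — and every convex `K ⊆ [-N, N]` (composite of the four landed pieces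
  `stub_reachDictionary` p140062, `stub_reachSingular` p140069, `stub_hlTuplesUniform` p140011, `stub_tuplesReach`
  p140223; the `t = 2` case is c1's `pairsReach_of_pairsHL`);
* `TupleLadder.reach_of_pairsHL_of_inputs` — hence `PairsHL ∧ TupleLevel ∧ TupleAtoms ⇒ Reach`;
* `engineToGHL_of_reachInputs` — the crux from `TupleLevel`, `TupleAtoms` and the SHARPER residual
  `Reach → DimOne`, whose content is exactly: non-unit SLOPES (`aᵢ n + bᵢ`, Sophie Germain-type systems), SHIFT
  UNIFORMITY (differences up to `2 L N`: Goldbach, `(n, n+h)` with `h ≤ L N` — the Landau–Siegel-complete layer,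
  `Negative.tuplesToGHL_false_of_unboundedSiegelZeros`), and the harmless `t = 1` (PNT in intervals);
* `reachToDimOne_of_engineToGHL` — that residual is WEAKER than the crux (the reach contains `PairsHL`,
  c1's `pairsHL_of_pairsReach`);
* `tuplesToDimOne_iff_reachToDimOne` — under `TupleLevel ∧ TupleAtoms` the two residuals `Tuples → DimOne` and
  `Reach → DimOne` are equivalent to each other (and to the crux).
-/

namespace Summit.Parity.GeneralizedHardyLittlewood.Theorems.EngineToGHL

open Summit.Parity.GeneralizedHardyLittlewood.Theses

/-- **Tuples ⇒ Reach.** Hardy–Littlewood in `Λ`-form on `[1,N]` for every finite unit-slope tuple `H ∋ 0`, `#H ≥ 2`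
gives the Green–Tao asymptotic for every non-degenerate unit-slope system of every length `t ≥ 2` with bounded shift
differences, uniformly in shifts up to `L N` and over all convex `K ⊆ [-N,N]`: the dictionary (`stub_reachDictionary`:
the prime-point sum is a block sum of `∏_{h∈H} Λ(m+h)`, `β_∞` = a length), the singular product (`stub_reachSingular`:
`∏_p β_p = 𝔖(H)`), the uniform `o(M)` (`stub_hlTuplesUniform`) and the assembly (`stub_tuplesReach`).
[cite: GreenTao2010, Conj. 1.2, Example 1, (1.2), (1.4), (1.6), (1.7)] -/
theorem TupleLadder.tuplesReach_of_hlTuples :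
    (∀ H : Finset ℕ, 0 ∈ H → 2 ≤ H.card → ((fun N : ℕ => ∑ n ∈ Finset.Icc 1 N, ∏ h ∈ H, ArithmeticFunction.vonMangoldt (n + h) - Literature.NumberTheory.Sieve.singularSeries ((H).image (fun h : ℕ => (h : ℤ))) * N) =o[Filter.atTop] fun N : ℕ => (N : ℝ))) →
    (∀ (t Hb L : ℕ) (ε : ℝ), 2 ≤ t → 0 < ε → ∃ N₀ : ℕ, ∀ N : ℕ, N₀ ≤ N → ∀ Ψ : Fin t → Literature.NumberTheory.Sieve.AffLinForm 1, Literature.NumberTheory.Sieve.IsNondegenerateSystem Ψ → Literature.NumberTheory.Sieve.affLinSize Ψ N ≤ L → (∀ i j, (Ψ i).coeff j = 1) → (∀ i j, |(Ψ i).const - (Ψ j).const| ≤ (Hb : ℤ)) → ∀ K : Set (Fin 1 → ℝ), Convex ℝ K → K ⊆ Literature.NumberTheory.Sieve.realBox 1 N → |Literature.NumberTheory.Sieve.vonMangoldtSum Ψ K N - Literature.NumberTheory.Sieve.archFactor Ψ K * Literature.NumberTheory.Sieve.singularProduct Ψ| ≤ ε * (N : ℝ)) :=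
  fun hT t Hb L ε ht hε => TupleLadder.stub_tuplesReach t Hb L ε ht hε TupleLadder.stub_reachDictionary
    TupleLadder.stub_reachSingular (TupleLadder.stub_hlTuplesUniform hT)

/-- **`PairsHL ∧ TupleLevel ∧ TupleAtoms ⇒ Reach`**: pairs, the relative tuple-EH and the tuple atoms already give
the Green–Tao asymptotic for all unit-slope systems with bounded shift differences (rung + reach). [folklore] -/
theorem TupleLadder.reach_of_pairsHL_of_inputs (hP : LiouvilleShiftedTables.PairsHL)
    (h2 : (∀ H : Finset ℕ, 0 ∈ H → 2 ≤ H.card → (∀ δ : ℝ, 0 < δ → ∀ B : ℝ, ∃ C : ℝ, ∀ N : ℕ, 2 ≤ N → ∀ y r : ℕ → ℕ, (∀ d, y d ≤ N) → (∑ d ∈ Finset.Icc 1 ⌊(N : ℝ) ^ (1 - δ)⌋₊, |(∑ n ∈ (Finset.Icc 1 (y d)).filter (fun n : ℕ => n ≡ r d [MOD d]), ∏ h ∈ H, ArithmeticFunction.vonMangoldt (n + h)) - (if ∀ h ∈ H, Nat.Coprime (r d + h) d then (((Finset.range d).filter (fun ρ : ℕ => ∀ h ∈ H, Nat.Coprime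 (ρ + h) d)).card : ℝ)⁻¹ else 0) * ∑ n ∈ Finset.Icc 1 (y d), ∏ h ∈ H, ArithmeticFunction.vonMangoldt (n + h)|) ≤ C * N / Real.log N ^ B)))
    (h3 : (∀ (H : Finset ℕ) (h : ℕ), 0 ∈ H → 2 ≤ H.card → h ∉ H → (∃ ε₀ : ℝ, 0 < ε₀ ∧ ∀ A : ℝ, 0 < A → ∃ C : ℝ, ∃ N₀ : ℕ, ∀ N : ℕ, N₀ ≤ N → ∀ w y : ℕ → ℕ, (∀ q, y q ≤ N) → (∑ q ∈ Finset.Icc 1 ⌊(N : ℝ) ^ ε₀⌋₊, |∑ n ∈ (Finset.Icc 1 (y q)).filter (fun n : ℕ => n ≡ w q [MOD q]), (ArithmeticFunction.liouville (n + h) : ℝ) * ∏ h' ∈ H, ArithmeticFunction.vonMangoldt (n + h')|) ≤ C * N / Real.log N ^ A))) :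
    (∀ (t Hb L : ℕ) (ε : ℝ), 2 ≤ t → 0 < ε → ∃ N₀ : ℕ, ∀ N : ℕ, N₀ ≤ N → ∀ Ψ : Fin t → Literature.NumberTheory.Sieve.AffLinForm 1, Literature.NumberTheory.Sieve.IsNondegenerateSystem Ψ → Literature.NumberTheory.Sieve.affLinSize Ψ N ≤ L → (∀ i j, (Ψ i).coeff j = 1) → (∀ i j, |(Ψ i).const - (Ψ j).const| ≤ (Hb : ℤ)) → ∀ K : Set (Fin 1 → ℝ), Convex ℝ K → K ⊆ Literature.NumberTheory.Sieve.realBox 1 N → |Literature.NumberTheory.Sieve.vonMangoldtSum Ψ K N - Literature.NumberTheory.Sieve.archFactor Ψ K * Literature.NumberTheory.Sieve.singularProduct Ψ| ≤ ε * (N : ℝ)) :=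
  TupleLadder.tuplesReach_of_hlTuples (TupleLadder.hlTuples_of_pairsHL hP h2 h3)

/-- **The crux from `TupleLevel`, `TupleAtoms` and the sharper residual `Reach → DimOne`.** [folklore] -/
theorem engineToGHL_of_reachInputs :
    (∀ H : Finset ℕ, 0 ∈ H → 2 ≤ H.card → (∀ δ : ℝ, 0 < δ → ∀ B : ℝ, ∃ C : ℝ, ∀ N : ℕ, 2 ≤ N → ∀ y r : ℕ → ℕ, (∀ d, y d ≤ N) → (∑ d ∈ Finset.Icc 1 ⌊(N : ℝ) ^ (1 - δ)⌋₊, |(∑ n ∈ (Finset.Icc 1 (y d)).filter (fun n : ℕ => n ≡ r d [MOD d]), ∏ h ∈ H, ArithmeticFunction.vonMangoldt (n + h)) - (if ∀ h ∈ H, Nat.Coprime (r d + h) d then (((Finset.range d).filter (fun ρ : ℕ => ∀ h ∈ H, Nat.Coprime (ρ + h) d)).card : ℝ)⁻¹ else 0) * ∑ n ∈ Finset.Icc 1 (y d), ∏ h ∈ H, ArithmeticFunction.vonMangoldt (n + h)|) ≤ C * N / Real.log N ^ B)) →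
    (∀ (H : Finset ℕ) (h : ℕ), 0 ∈ H → 2 ≤ H.card → h ∉ H → (∃ ε₀ : ℝ, 0 < ε₀ ∧ ∀ A : ℝ, 0 < A → ∃ C : ℝ, ∃ N₀ : ℕ, ∀ N : ℕ, N₀ ≤ N → ∀ w y : ℕ → ℕ, (∀ q, y q ≤ N) → (∑ q ∈ Finset.Icc 1 ⌊(N : ℝ) ^ ε₀⌋₊, |∑ n ∈ (Finset.Icc 1 (y q)).filter (fun n : ℕ => n ≡ w q [MOD q]), (ArithmeticFunction.liouville (n + h) : ℝ) * ∏ h' ∈ H, ArithmeticFunction.vonMangoldt (n + h')|) ≤ C * N / Real.log N ^ A)) →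
    ((∀ (t Hb L : ℕ) (ε : ℝ), 2 ≤ t → 0 < ε → ∃ N₀ : ℕ, ∀ N : ℕ, N₀ ≤ N → ∀ Ψ : Fin t → Literature.NumberTheory.Sieve.AffLinForm 1, Literature.NumberTheory.Sieve.IsNondegenerateSystem Ψ → Literature.NumberTheory.Sieve.affLinSize Ψ N ≤ L → (∀ i j, (Ψ i).coeff j = 1) → (∀ i j, |(Ψ i).const - (Ψ j).const| ≤ (Hb : ℤ)) → ∀ K : Set (Fin 1 → ℝ), Convex ℝ K → K ⊆ Literature.NumberTheory.Sieve.realBox 1 N → |Literature.NumberTheory.Sieve.vonMangoldtSum Ψ K N - Literature.NumberTheory.Sieve.archFactor Ψ K * Literature.NumberTheory.Sieve.singularProduct Ψ| ≤ ε * (N : ℝ)) → ∀ (t L : ℕ), 1 ≤ t → ∀ ε : ℝ, 0 < ε → ∃ N₀ : ℕ, ∀ N : ℕ, N₀ ≤ N → ∀ Ψ : Fin t → Literature.NumberTheory.Sieve.AffLinForm 1, Literature.NumberTheory.Sieve.IsNondegenerateSystem Ψ → Literature.NumberTheory.Sieve.affLinSize Ψ N ≤ L → ∀ K : Set (Fin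 1 → ℝ), Convex ℝ K → K ⊆ Literature.NumberTheory.Sieve.realBox 1 N → |Literature.NumberTheory.Sieve.vonMangoldtSum Ψ K N - Literature.NumberTheory.Sieve.archFactor Ψ K * Literature.NumberTheory.Sieve.singularProduct Ψ| ≤ ε * (N : ℝ)) →
    Summit.Parity.GeneralizedHardyLittlewood.Theses.LiouvilleMAD.EngineToGHL :=
  fun h2 h3 h4 => engineToGHL_of_tupleInputs h2 h3 fun hT => h4 (TupleLadder.tuplesReach_of_hlTuples hT)

/-- **The residual `Reach → DimOne` is WEAKER than the crux**: the reach (its `t = 2` part) contains `PairsHL`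
(`pairsHL_of_pairsReach`), and `EngineToGHL ↔ (PairsHL → DimOne)`. [folklore] -/
theorem reachToDimOne_of_engineToGHL
    (hX : Summit.Parity.GeneralizedHardyLittlewood.Theses.LiouvilleMAD.EngineToGHL) :
    (∀ (t Hb L : ℕ) (ε : ℝ), 2 ≤ t → 0 < ε → ∃ N₀ : ℕ, ∀ N : ℕ, N₀ ≤ N → ∀ Ψ : Fin t → Literature.NumberTheory.Sieve.AffLinForm 1, Literature.NumberTheory.Sieve.IsNondegenerateSystem Ψ → Literature.NumberTheory.Sieve.affLinSize Ψ N ≤ L → (∀ i j, (Ψ i).coeff j = 1) → (∀ i j, |(Ψ i).const - (Ψ j).const| ≤ (Hb : ℤ)) → ∀ K : Set (Fin 1 → ℝ), Convex ℝ K → K ⊆ Literature.NumberTheory.Sieve.realBox 1 N → |Literature.NumberTheory.Sieve.vonMangoldtSum Ψ K N - Literature.NumberTheory.Sieve.archFactor Ψ K * Literature.NumberTheory.Sieve.singularProduct Ψ| ≤ ε * (N : ℝ)) → ∀ (t L : ℕ), 1 ≤ t → ∀ ε : ℝ, 0 < ε → ∃ N₀ : ℕ, ∀ N : ℕ, N₀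 ≤ N → ∀ Ψ : Fin t → Literature.NumberTheory.Sieve.AffLinForm 1, Literature.NumberTheory.Sieve.IsNondegenerateSystem Ψ → Literature.NumberTheory.Sieve.affLinSize Ψ N ≤ L → ∀ K : Set (Fin 1 → ℝ), Convex ℝ K → K ⊆ Literature.NumberTheory.Sieve.realBox 1 N → |Literature.NumberTheory.Sieve.vonMangoldtSum Ψ K N - Literature.NumberTheory.Sieve.archFactor Ψ K * Literature.NumberTheory.Sieve.singularProduct Ψ| ≤ ε * (N : ℝ) := by
  intro hR
  refine engineToGHL_iff_pairsHL_imp_dimOne.mp hX (pairsHL_of_pairsReach ?_)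
  intro Hb L ε hε
  obtain ⟨N₀, hN₀⟩ := hR 2 Hb L ε le_rfl hε
  refine ⟨N₀, fun N hN Ψ hnd hL hcoeff hHb K hK hKN => hN₀ N hN Ψ hnd hL hcoeff ?_ K hK hKN⟩
  intro i j
  fin_cases i <;> fin_cases j
  · simp
  · simpa [abs_sub_comm] using hHb
  · simpa using hHb
  · simp

/-- **Under `TupleLevel ∧ TupleAtoms` the residuals `Tuples → DimOne` and `Reach → DimOne` are equivalent** (both to
the crux): `⇒` because the reach contains pairs and pairs + inputs give all tuples; `⇐` because tuples give the reach.
[folklore] -/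
theorem tuplesToDimOne_iff_reachToDimOne
    (h2 : (∀ H : Finset ℕ, 0 ∈ H → 2 ≤ H.card → (∀ δ : ℝ, 0 < δ → ∀ B : ℝ, ∃ C : ℝ, ∀ N : ℕ, 2 ≤ N → ∀ y r : ℕ → ℕ, (∀ d, y d ≤ N) → (∑ d ∈ Finset.Icc 1 ⌊(N : ℝ) ^ (1 - δ)⌋₊, |(∑ n ∈ (Finset.Icc 1 (y d)).filter (fun n : ℕ => n ≡ r d [MOD d]), ∏ h ∈ H, ArithmeticFunction.vonMangoldt (n + h)) - (if ∀ h ∈ H, Nat.Coprime (r d + h) d then (((Finset.range d).filter (fun ρ : ℕ => ∀ h ∈ H, Nat.Coprime (ρ + h) d)).card : ℝ)⁻¹ else 0) * ∑ n ∈ Finset.Icc 1 (y d), ∏ h ∈ H, ArithmeticFunction.vonMangoldt (n + h)|) ≤ C * N / Real.log N ^ B)))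
    (h3 : (∀ (H : Finset ℕ) (h : ℕ), 0 ∈ H → 2 ≤ H.card → h ∉ H → (∃ ε₀ : ℝ, 0 < ε₀ ∧ ∀ A : ℝ, 0 < A → ∃ C : ℝ, ∃ N₀ : ℕ, ∀ N : ℕ, N₀ ≤ N → ∀ w y : ℕ → ℕ, (∀ q, y q ≤ N) → (∑ q ∈ Finset.Icc 1 ⌊(N : ℝ) ^ ε₀⌋₊, |∑ n ∈ (Finset.Icc 1 (y q)).filter (fun n : ℕ => n ≡ w q [MOD q]), (ArithmeticFunction.liouville (n + h) : ℝ) * ∏ h' ∈ H, ArithmeticFunction.vonMangoldt (n + h')|) ≤ C * N / Real.log N ^ A))) :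
    ((∀ H : Finset ℕ, 0 ∈ H → 2 ≤ H.card → ((fun N : ℕ => ∑ n ∈ Finset.Icc 1 N, ∏ h ∈ H, ArithmeticFunction.vonMangoldt (n + h) - Literature.NumberTheory.Sieve.singularSeries ((H).image (fun h : ℕ => (h : ℤ))) * N) =o[Filter.atTop] fun N : ℕ => (N : ℝ))) → ∀ (t L : ℕ), 1 ≤ t → ∀ ε : ℝ, 0 < ε → ∃ N₀ : ℕ, ∀ N : ℕ, N₀ ≤ N → ∀ Ψ : Fin t → Literature.NumberTheory.Sieve.AffLinForm 1, Literature.NumberTheory.Sieve.IsNondegenerateSystem Ψ → Literature.NumberTheory.Sieve.affLinSize Ψ N ≤ L → ∀ K : Set (Fin 1 → ℝ), Convex ℝ K → K ⊆ Literature.NumberTheory.Sieve.realBox 1 N → |Literature.NumberTheory.Sieve.vonMangoldtSum Ψ K N - Literature.NumberTheory.Sieve.archFactor Ψ K * Literature.NumberTheory.Sieve.singularProduct Ψ| ≤ ε * (N : ℝ)) ↔ ((∀ (t Hb L : ℕ) (ε : ℝ), 2 ≤ t → 0 < ε → ∃ N₀ : ℕ, ∀ N : ℕ, N₀ ≤ N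 → ∀ Ψ : Fin t → Literature.NumberTheory.Sieve.AffLinForm 1, Literature.NumberTheory.Sieve.IsNondegenerateSystem Ψ → Literature.NumberTheory.Sieve.affLinSize Ψ N ≤ L → (∀ i j, (Ψ i).coeff j = 1) → (∀ i j, |(Ψ i).const - (Ψ j).const| ≤ (Hb : ℤ)) → ∀ K : Set (Fin 1 → ℝ), Convex ℝ K → K ⊆ Literature.NumberTheory.Sieve.realBox 1 N → |Literature.NumberTheory.Sieve.vonMangoldtSum Ψ K N - Literature.NumberTheory.Sieve.archFactor Ψ K * Literature.NumberTheory.Sieve.singularProduct Ψ| ≤ ε * (N : ℝ)) → ∀ (t L : ℕ), 1 ≤ t → ∀ ε : ℝ, 0 < ε → ∃ N₀ : ℕ, ∀ N : ℕ, N₀ ≤ N → ∀ Ψ : Fin t → Literature.NumberTheory.Sieve.AffLinForm 1, Literature.NumberTheory.Sieve.IsNondegenerateSystem Ψ → Literature.NumberTheory.Sieve.affLinSize Ψ N ≤ L → ∀ K : Set (Fin 1 → ℝ), Convex ℝ K → K ⊆ Literature.NumberTheory.Sieve.realBox 1 N → |Literature.NumberTheory.Sieve.vonMangoldtSum Ψ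 K N - Literature.NumberTheory.Sieve.archFactor Ψ K * Literature.NumberTheory.Sieve.singularProduct Ψ| ≤ ε * (N : ℝ)) := by
  constructor
  · intro h4
    exact reachToDimOne_of_engineToGHL (engineToGHL_of_tupleInputs h2 h3 h4)
  · intro h4 hT
    exact h4 (TupleLadder.tuplesReach_of_hlTuples hT)

end Summit.Parity.GeneralizedHardyLittlewood.Theorems.EngineToGHL
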